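import Mathlib

/-!
# The partition lemma and the sprinkle test — a schema for «RH ⟸ X₁ ∧ X₂» split claims

Desk schema (rh-idea-7 g0, 2026-08-27; memo `pub/ideators/rh-idea-7/A-SEARCH.md` c79df88af2334015,
adopted as the director's standard for (a)-claims, REQUESTS.md 22:46:50Z). Suggested home:
`Summits/RiemannHypothesis/RiemannHypothesis/Theorems/SprinkleTest.lean` (our own uncited schema, so not
`Literature/`; the barrier-catalogue seat cites it from `Summits/RiemannHypothesis/BARRIERS.md`); everything
below is sorry-free logic over Mathlib and says NOTHING about `riemannZeta` — it is the bookkeeping every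
split claim is read against, not a theorem about ζ. Nothing here bears on the truth of RH.

## Reading

A *piece* `X` of a split is read on the configuration side as a predicate `P : ZeroConfig → Prop` on
hypothetical off-line zero configurations (`Z` = the off-line zeros in the upper right quarter of the
critical strip; the other three members of each quadruple are implied by the two symmetries; `Z = ∅` is
the RH world). `P Z` means "the world with off-line configuration `Z` (and everything else as under RH)
satisfies `X`", i.e. `X` TOLERATES `Z`.

* `RHStrength P` : `P` tolerates only `∅` — then `X ⇒ RH` and `X` is not strictly weaker than RH.
* PARTITION LEMMA (`partition_lemma`, `split_forces_killer`): in a split `IsSplit P₁ P₂` the tolerated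
  classes are disjoint; if `P₁` tolerates arbitrarily high sprinkles then `P₂` must kill arbitrarily high
  sprinkles — `P₂` carries the generic difficulty of RH ("which piece kills the sprinkle class, and by what
  named technique?" is the question every (a)-claim must answer).
* SPRINKLE TEST (`sprinkleTolerant_truncation`, `full_family_kills_singleton`): a TRUNCATED positivity
  class is a weighted-threshold family `∑_{ρ ∈ Z} w N ρ ≤ B N, N ≤ N₀` whose weights vanish at large
  height for each fixed `N`; such a truncation tolerates a single high quadruple, while the full family
  (`∀ N`) kills every singleton as soon as `w N ρ` eventually exceeds `B N`. So "positivity up to `N₀`" ∧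
  "positivity beyond `N₀`" is a partition BY LOCATION `(Re ρ, Im ρ)` of the single zero — a θ/height split
  in costume.

## The five instances (remarks; thresholds from the memo, orders of magnitude only)

1. Integer screw `S_M ≻ 0` for `M ≤ M₀` (`Theorems.IntegerScrew`): a quadruple `ρ₀ = ½+η₀+iγ₀` enters
   `v* S_M v` with weight `≍ m_ρ M^{2η₀}/γ₀²` against a bulk of size `≍ (log M)/4`; tolerated while
   `γ₀² ≳ M₀^{2η₀} log M₀`; the full family is RH-equivalent (`posDef_screwMatrix_iff_RH`).
2. Weil positivity for test functions with `supp f ⊆ [−log N, log N]`: weight `≍ N^{2η₀}/γ₀²`-type; full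
   class ⟺ RH (Weil, Bombieri).
3. Li coefficients `λ_n ≥ 0`, `n ≤ n₀`: `Re (1 − (1 − 1/ρ₀)^n) ≈ 2 n η₀/|ρ₀|²` for `|ρ₀| ≫ n`, positive and
   small — tolerated; all `n` ⟺ RH (Li 1997, Bombieri–Lagarias 1999).
4. Jensen polynomials `J^{d,n}` hyperbolic for `d ≤ D`: proved for each `d` and `n ≫ d`
   (Griffin–Ono–Rolen–Zagier 2019) — the proved part is the sprinkle-blind part; all `(d,n)` ⟺ RH.
5. Nyman–Beurling distances `d_N → 0` at a RATE up to `N ≤ N₀`: any finite-range statement is blind to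
   high quadruples (Burnol's formula weights a zero by `|ρ|^{-2}`); `d_N → 0` ⟺ RH.

TWISTED-MERTENS remark: a MEAN-VALUE piece that does kill sprinkles hides a sup-statement at the
sprinkle's ordinate — `Literature.Barriers.RiemannHypothesis.BettinGonek2017_thm1/_thm2`: the long-mollifier
moment bound up to length `T^θ` is a zero-free half-plane `Re s > ½ + 1/(2θ)`; `θ = ∞` is ≥ RH.
Director's reading of X-11 (REQUESTS.md 22:46:50Z): a finite sprinkle gives a finite aliased pole set, so
`DustWall` tolerates sprinkles and `Ceil` is the killing piece.
-/

noncomputable section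

set_option linter.dupNamespace false  -- the mandated namespace repeats `RiemannHypothesis`

open Complex Finset

namespace Summit.RiemannHypothesis.RiemannHypothesis.Theorems.SprinkleTest

/-- An off-line zero configuration: finitely many points, read as the hypothetical off-line zeros of `ζ`
in the upper right quarter `½ < Re ρ < 1, Im ρ > 0` of the critical strip. `∅` is the RH world; a
non-empty one is a *sprinkle*. -/
abbrev ZeroConfig := Finset ℂ

/-- `ρ` is an admissible off-line position at height at least `T`. -/
def OffLineAbove (T : ℝ) (ρ : ℂ) : Prop := 1 / 2 < ρ.re ∧ ρ.re < 1 ∧ T ≤ ρ.im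

/-- A sprinkle above height `T`: non-empty, every point off-line at height `≥ T`. -/
def IsSprinkleAbove (T : ℝ) (Z : ZeroConfig) : Prop := Z.Nonempty ∧ ∀ ρ ∈ Z, OffLineAbove T ρ

/-- The piece tolerates only the empty configuration: on the configuration side it is at least as
strong as RH. -/
def RHStrength (P : ZeroConfig → Prop) : Prop := ∀ Z, P Z → Z = ∅

/-- The piece tolerates some non-empty configuration (the configuration-side reading of
"strictly weaker than RH"). -/
def Tolerant (P : ZeroConfig → Prop) : Prop := ∃ Z : ZeroConfig, Z.Nonempty ∧ P Z

/-- The piece tolerates sprinkles at every height. -/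
def SprinkleTolerant (P : ZeroConfig → Prop) : Prop := ∀ T : ℝ, ∃ Z, IsSprinkleAbove T Z ∧ P Z

/-- The piece kills every sprinkle above height `T`. -/
def KillsSprinklesAbove (T : ℝ) (P : ZeroConfig → Prop) : Prop := ∀ Z, IsSprinkleAbove T Z → ¬ P Z

/-- `P₁ ∧ P₂` is a split of RH on the configuration side: jointly they tolerate only `∅`. -/
def IsSplit (P₁ P₂ : ZeroConfig → Prop) : Prop := ∀ Z, P₁ Z → P₂ Z → Z = ∅

/-! ## The partition lemma -/

/-- A piece is tolerant (some non-empty configuration satisfies it) iff it is not of RH-strength. -/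
theorem tolerant_iff_not_rhStrength (P : ZeroConfig → Prop) : Tolerant P ↔ ¬ RHStrength P := by
  constructor
  · rintro ⟨Z, hZ, hP⟩ h
    exact hZ.ne_empty (h Z hP)
  · intro h
    by_contra h'
    exact h fun Z hP => by
      by_contra hne
      exact h' ⟨Z, Finset.nonempty_iff_ne_empty.2 hne, hP⟩

/-- A piece violated by every non-empty configuration is at least RH-strength (contrapositive form of
`tolerant_iff_not_rhStrength`). -/
theorem rhStrength_of_forall_not (P : ZeroConfig → Prop) (h : ∀ Z : ZeroConfig, Z.Nonempty → ¬ P Z) :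
    RHStrength P := fun Z hP => by
  by_contra hne
  exact h Z (Finset.nonempty_iff_ne_empty.2 hne) hP

/-- PARTITION LEMMA: in a split the tolerated classes are disjoint — no non-empty configuration is
tolerated by both pieces. -/
theorem partition_lemma {P₁ P₂ : ZeroConfig → Prop} (h : IsSplit P₁ P₂) (Z : ZeroConfig)
    (hZ : Z.Nonempty) : ¬ (P₁ Z ∧ P₂ Z) := fun hP => hZ.ne_empty (h Z hP.1 hP.2)

/-- In a split with both pieces strictly weaker, each piece tolerates a non-empty class and the two
classes are disjoint: a split IS a partition of the counter-scenarios. -/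
theorem split_is_partition {P₁ P₂ : ZeroConfig → Prop} (h : IsSplit P₁ P₂) (h₁ : Tolerant P₁)
    (h₂ : Tolerant P₂) :
    (∃ Z₁ : ZeroConfig, Z₁.Nonempty ∧ P₁ Z₁ ∧ ¬ P₂ Z₁) ∧
      (∃ Z₂ : ZeroConfig, Z₂.Nonempty ∧ P₂ Z₂ ∧ ¬ P₁ Z₂) := by
  obtain ⟨Z₁, hZ₁, hP₁⟩ := h₁
  obtain ⟨Z₂, hZ₂, hP₂⟩ := h₂
  exact ⟨⟨Z₁, hZ₁, hP₁, fun hP₂' => partition_lemma h Z₁ hZ₁ ⟨hP₁, hP₂'⟩⟩,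
    ⟨Z₂, hZ₂, hP₂, fun hP₁' => partition_lemma h Z₂ hZ₂ ⟨hP₁', hP₂⟩⟩⟩

/-- A sprinkle-tolerant piece is tolerant, hence not RH-strength. -/
theorem SprinkleTolerant.tolerant {P : ZeroConfig → Prop} (h : SprinkleTolerant P) : Tolerant P := by
  obtain ⟨Z, ⟨hZ, -⟩, hP⟩ := h 0
  exact ⟨Z, hZ, hP⟩

/-- A sprinkle-tolerant piece is not RH-strength. -/
theorem SprinkleTolerant.not_rhStrength {P : ZeroConfig → Prop} (h : SprinkleTolerant P) :
    ¬ RHStrength P :=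
  (tolerant_iff_not_rhStrength P).1 h.tolerant

/-- THE QUESTION EVERY (a)-CLAIM MUST ANSWER: if one piece of a split tolerates arbitrarily high
sprinkles, the other piece kills arbitrarily high sprinkles — it carries the generic difficulty. -/
theorem split_forces_killer {P₁ P₂ : ZeroConfig → Prop} (h : IsSplit P₁ P₂)
    (h₁ : SprinkleTolerant P₁) (T : ℝ) : ∃ Z, IsSprinkleAbove T Z ∧ ¬ P₂ Z := by
  obtain ⟨Z, hZ, hP₁⟩ := h₁ T
  exact ⟨Z, hZ, fun hP₂ => partition_lemma h Z hZ.1 ⟨hP₁, hP₂⟩⟩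

/-- Conversely, a piece that kills all sprinkles above some height cannot be paired with a
sprinkle-tolerant class of the SAME sprinkles: if `P₂` kills sprinkles above `T` then every
configuration tolerated by both pieces has a point below height `T` or on/inside no admissible
position — i.e. the residual split is a HEIGHT split. -/
theorem tolerated_meets_low_region {P₂ : ZeroConfig → Prop} {T : ℝ}
    (h₂ : KillsSprinklesAbove T P₂) (Z : ZeroConfig) (hZ : Z.Nonempty) (hP₂ : P₂ Z) :
    ∃ ρ ∈ Z, ¬ OffLineAbove T ρ := by
  by_contra hc
  exact h₂ Z ⟨hZ, fun ρ hρ => by_contra fun hn => hc ⟨ρ, hρ, hn⟩⟩ hP₂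

/-! ## The sprinkle test for truncated positivity classes -/

/-- The `N`-th member of a weighted-threshold family: the configuration's total weight at level `N`
stays below the bulk `B N`. (Screw: `w M ρ ≍ m_ρ M^{2 Re ρ - 1}/(Im ρ)²`, `B M ≍ (log M)/4`.) -/
def weightPiece (w : ℕ → ℂ → ℝ) (B : ℕ → ℝ) (N : ℕ) : ZeroConfig → Prop :=
  fun Z => ∑ ρ ∈ Z, w N ρ ≤ B N

/-- The truncated class: all levels `N ≤ N₀`. -/
def truncation (w : ℕ → ℂ → ℝ) (B : ℕ → ℝ) (N₀ : ℕ) : ZeroConfig → Prop :=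
  fun Z => ∀ N ≤ N₀, weightPiece w B N Z

/-- The full class: all levels. -/
def fullFamily (w : ℕ → ℂ → ℝ) (B : ℕ → ℝ) : ZeroConfig → Prop :=
  fun Z => ∀ N, weightPiece w B N Z

/-- The explicit high off-line point used as the one-point sprinkle. -/
def sprinklePoint (T : ℝ) : ℂ := (3 / 4 : ℂ) + (T : ℂ) * I

/-- Real part of the sprinkle point. -/
@[simp] theorem sprinklePoint_re (T : ℝ) : (sprinklePoint T).re = 3 / 4 := by
  simp [sprinklePoint]

/-- Imaginary part of the sprinkle point. -/
@[simp] theorem sprinklePoint_im (T : ℝ) : (sprinklePoint T).im = T := by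
  simp [sprinklePoint]

/-- The sprinkle point at height `T' ≥ T` is an admissible off-line position above `T`. -/
theorem offLineAbove_sprinklePoint {T T' : ℝ} (h : T ≤ T') : OffLineAbove T (sprinklePoint T') := by
  refine ⟨?_, ?_, ?_⟩
  · rw [sprinklePoint_re]; norm_num
  · rw [sprinklePoint_re]; norm_num
  · rw [sprinklePoint_im]; exact h

/-- The one-point configuration at the sprinkle point is a sprinkle above `T`. -/
theorem isSprinkleAbove_singleton {T T' : ℝ} (h : T ≤ T') :
    IsSprinkleAbove T ({sprinklePoint T'} : ZeroConfig) :=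
  ⟨Finset.singleton_nonempty _, fun ρ hρ => by
    rw [Finset.mem_singleton] at hρ; subst hρ; exact offLineAbove_sprinklePoint h⟩

/-- SPRINKLE TEST, tolerant half: if every level's weight is eventually (in height) below a uniform
positive floor `b` of the bulks, uniformly over the finitely many levels `N ≤ N₀`, then the truncated
class tolerates a one-point sprinkle at every height. -/
theorem sprinkleTolerant_truncation (w : ℕ → ℂ → ℝ) (B : ℕ → ℝ) {b : ℝ}
    (hB : ∀ N, b ≤ B N)
    (hw : ∀ N₀ : ℕ, ∃ T : ℝ, ∀ N ≤ N₀, ∀ ρ : ℂ, OffLineAbove T ρ → w N ρ ≤ b) (N₀ : ℕ) :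
    SprinkleTolerant (truncation w B N₀) := by
  intro T
  obtain ⟨T₁, hT₁⟩ := hw N₀
  refine ⟨{sprinklePoint (max T T₁)}, isSprinkleAbove_singleton (le_max_left _ _), ?_⟩
  intro N hN
  show ∑ ρ ∈ ({sprinklePoint (max T T₁)} : Finset ℂ), w N ρ ≤ B N
  rw [Finset.sum_singleton]
  exact (hT₁ N hN _ (offLineAbove_sprinklePoint (le_max_right _ _))).trans (hB N)

/-- Hence no truncated class of this kind is RH-strength. -/
theorem truncation_not_rhStrength (w : ℕ → ℂ → ℝ) (B : ℕ → ℝ) {b : ℝ} (hB : ∀ N, b ≤ B N)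
    (hw : ∀ N₀ : ℕ, ∃ T : ℝ, ∀ N ≤ N₀, ∀ ρ : ℂ, OffLineAbove T ρ → w N ρ ≤ b) (N₀ : ℕ) :
    ¬ RHStrength (truncation w B N₀) :=
  (sprinkleTolerant_truncation w B hB hw N₀).not_rhStrength

/-- SPRINKLE TEST, killing half: if for every admissible off-line point some level's weight exceeds
its bulk (screw: `M^{2η₀}/γ₀²` eventually beats `(log M)/4`), then the FULL family kills every
one-point sprinkle (with non-negative weights it kills every sprinkle, `fullFamily_kills_sprinkles`). -/
theorem fullFamily_kills_singleton (w : ℕ → ℂ → ℝ) (B : ℕ → ℝ)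
    (hdom : ∀ ρ : ℂ, 1 / 2 < ρ.re → ρ.re < 1 → ∃ N, B N < w N ρ) (ρ : ℂ) (h₁ : 1 / 2 < ρ.re)
    (h₂ : ρ.re < 1) : ¬ fullFamily w B {ρ} := by
  intro h
  obtain ⟨N, hN⟩ := hdom ρ h₁ h₂
  have := h N
  simp only [weightPiece, Finset.sum_singleton] at this
  exact absurd this (not_le.2 hN)

/-- With non-negative weights the full family kills every sprinkle (at any height), since a sprinkle
contains an admissible point whose own weight already exceeds some bulk. -/
theorem fullFamily_kills_sprinkles (w : ℕ → ℂ → ℝ) (B : ℕ → ℝ) (hw0 : ∀ N ρ, 0 ≤ w N ρ)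
    (hdom : ∀ ρ : ℂ, 1 / 2 < ρ.re → ρ.re < 1 → ∃ N, B N < w N ρ) (T : ℝ) :
    KillsSprinklesAbove T (fullFamily w B) := by
  rintro Z ⟨hZ, hoff⟩ h
  obtain ⟨ρ, hρ⟩ := hZ
  obtain ⟨N, hN⟩ := hdom ρ (hoff ρ hρ).1 (hoff ρ hρ).2.1
  have hle : w N ρ ≤ ∑ ρ' ∈ Z, w N ρ' :=
    Finset.single_le_sum (fun ρ' _ => hw0 N ρ') hρ
  exact absurd ((hle.trans (h N))) (not_le.2 hN)

/-- THE DICHOTOMY IN ONE LINE: under the two hypotheses, "positivity up to `N₀`" tolerates high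
sprinkles for every `N₀` while "positivity for all `N`" kills them all — so the split
`truncation N₀ ∧ (levels beyond N₀)` assigns the whole sprinkle class to the second piece, and what that
piece must exclude is parametrised by the location `(Re ρ, Im ρ)` of a single zero. -/
theorem sprinkle_dichotomy (w : ℕ → ℂ → ℝ) (B : ℕ → ℝ) {b : ℝ} (hB : ∀ N, b ≤ B N)
    (hw0 : ∀ N ρ, 0 ≤ w N ρ)
    (hw : ∀ N₀ : ℕ, ∃ T : ℝ, ∀ N ≤ N₀, ∀ ρ : ℂ, OffLineAbove T ρ → w N ρ ≤ b)
    (hdom : ∀ ρ : ℂ, 1 / 2 < ρ.re → ρ.re < 1 → ∃ N, B N < w N ρ) :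
    (∀ N₀, SprinkleTolerant (truncation w B N₀)) ∧ ∀ T, KillsSprinklesAbove T (fullFamily w B) :=
  ⟨sprinkleTolerant_truncation w B hB hw, fullFamily_kills_sprinkles w B hw0 hdom⟩

/-! ## A model instance (the hypotheses of `sprinkle_dichotomy` are jointly satisfiable)

Screw-shaped weights `w N ρ = N^{2 Re ρ − 1} / max 1 (Im ρ)²` against the constant bulk `B N = 1`:
each truncation tolerates high one-point sprinkles, the full family kills every sprinkle. (Orders of
magnitude of instance 1 of the module docstring, with the bulk frozen to a constant; no `ζ` anywhere.) -/

/-- Model weights `N^{2 Re ρ - 1} / max 1 (Im ρ)^2`. -/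
def modelWeight (N : ℕ) (ρ : ℂ) : ℝ := (N : ℝ) ^ (2 * ρ.re - 1) / max 1 (ρ.im ^ 2)

/-- Model bulk: constant `1`. -/
def modelBulk (_N : ℕ) : ℝ := 1

/-- Model weights are non-negative. -/
theorem modelWeight_nonneg (N : ℕ) (ρ : ℂ) : 0 ≤ modelWeight N ρ :=
  div_nonneg (Real.rpow_nonneg (Nat.cast_nonneg N) _) (le_trans zero_le_one (le_max_left _ _))

/-- Below level `N₀`, an admissible point at height `≥ N₀ + 1` has weight `≤ 1`. -/
theorem modelWeight_le_one {N₀ N : ℕ} (hN : N ≤ N₀) {ρ : ℂ} (hρ : OffLineAbove ((N₀ : ℝ) + 1) ρ) :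
    modelWeight N ρ ≤ 1 := by
  obtain ⟨h₁, h₂, h₃⟩ := hρ
  have hT : (1 : ℝ) ≤ (N₀ : ℝ) + 1 := by
    have := (Nat.cast_nonneg N₀ : (0 : ℝ) ≤ N₀); linarith
  have him : (N₀ : ℝ) + 1 ≤ ρ.im ^ 2 := by
    have h0 : (0 : ℝ) ≤ (N₀ : ℝ) + 1 := by linarith
    calc (N₀ : ℝ) + 1 ≤ ((N₀ : ℝ) + 1) ^ 2 := by nlinarith
      _ ≤ ρ.im ^ 2 := by
          have := h₃; exact pow_le_pow_left₀ h0 this 2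
  have hmax : (N₀ : ℝ) + 1 ≤ max 1 (ρ.im ^ 2) := him.trans (le_max_right _ _)
  have hpos : (0 : ℝ) < max 1 (ρ.im ^ 2) := lt_of_lt_of_le one_pos (le_max_left _ _)
  -- numerator ≤ N ≤ N₀
  have hnum : (N : ℝ) ^ (2 * ρ.re - 1) ≤ (N₀ : ℝ) + 1 := by
    rcases Nat.eq_zero_or_pos N with hz | hposN
    · subst hz
      rw [Nat.cast_zero, Real.zero_rpow (by linarith)]
      linarith
    · have h1N : (1 : ℝ) ≤ (N : ℝ) := by exact_mod_cast hposN
      calc (N : ℝ) ^ (2 * ρ.re - 1) ≤ (N : ℝ) ^ (1 : ℝ) :=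
            Real.rpow_le_rpow_of_exponent_le h1N (by linarith)
        _ = N := Real.rpow_one _
        _ ≤ N₀ := by exact_mod_cast hN
        _ ≤ (N₀ : ℝ) + 1 := by linarith
  rw [modelWeight, div_le_one hpos]
  exact hnum.trans hmax

/-- Every admissible off-line point is eventually (in `N`) heavier than the bulk. -/
theorem modelWeight_eventually_large (ρ : ℂ) (h₁ : 1 / 2 < ρ.re) (_h₂ : ρ.re < 1) :
    ∃ N : ℕ, modelBulk N < modelWeight N ρ := by
  have he : 0 < 2 * ρ.re - 1 := by linarith
  have hpos : (0 : ℝ) < max 1 (ρ.im ^ 2) := lt_of_lt_of_le one_pos (le_max_left _ _)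
  have ht : Filter.Tendsto (fun N : ℕ => (N : ℝ) ^ (2 * ρ.re - 1)) Filter.atTop Filter.atTop :=
    (tendsto_rpow_atTop he).comp tendsto_natCast_atTop_atTop
  obtain ⟨N, hN⟩ := (ht.eventually_gt_atTop (max 1 (ρ.im ^ 2))).exists
  refine ⟨N, ?_⟩
  rw [modelBulk, modelWeight, lt_div_iff₀ hpos, one_mul]
  exact hN

/-- The model satisfies the sprinkle dichotomy: truncations tolerate, the full family kills. -/
theorem model_dichotomy :
    (∀ N₀, SprinkleTolerant (truncation modelWeight modelBulk N₀)) ∧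
      ∀ T, KillsSprinklesAbove T (fullFamily modelWeight modelBulk) :=
  sprinkle_dichotomy modelWeight modelBulk (b := 1) (fun _ => le_rfl) modelWeight_nonneg
    (fun N₀ => ⟨(N₀ : ℝ) + 1, fun _ hN _ hρ => modelWeight_le_one hN hρ⟩)
    (fun ρ h₁ h₂ => modelWeight_eventually_large ρ h₁ h₂)

end Summit.RiemannHypothesis.RiemannHypothesis.Theorems.SprinkleTest
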